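/-
# Solo-blind programme on Kontsevich–Zagier, s6 part T5c: values of the Rogers classes

In Rogers' normalisation `R(x) = 2[D(x)] + ℓ(1/x)·ℓ(1/(1−x))` (`SoloBlindRogers.rog`, period
`2L(x)`) the landed evaluations of the dilogarithm sector lose their logarithmic terms and become
rational multiples of `x_π²` — as identities of KZ classes in `Q`:

* reflection `R(x) + R(1−x) = 2[Λ₂]` (`= x_π²/3`), so `R(1/2) = [Λ₂]`;
* `5·R(1/φ) = x_π²`, `15·R(1/φ²) = 2·x_π²` (Landen's golden values);
* `6·R(1/3) − R(1/9) = 4[Λ₂]` (Ramanujan's ladder),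

with period shadows `L(1/2) = π²/12`, `L(1/φ) = π²/10`, `L(1/φ²) = π²/15`,
`6L(1/3) − L(1/9) = π²/3`.
-/
import Summits.KontsevichZagierPeriods.KontsevichZagierPeriods.Theorems.SoloBlindRogers
import Summits.KontsevichZagierPeriods.KontsevichZagierPeriods.Theorems.SoloBlindRamanujanLadder

noncomputable section

open MeasureTheory Set
open scoped goldenRatio
open Literature.NumberTheory.Transcendental
open Literature.NumberTheory.Transcendental.KZ
open Literature.NumberTheory.Transcendental.KZ.IntegralRep

namespace Summit.KontsevichZagierPeriods.KontsevichZagierPeriods.Theorems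

namespace SoloBlind

/-! ## Reflection and the value at `1/2` -/

/-- **Euler's reflection in Rogers' form:** `R(x) + R(1−x) = 2[Λ₂]`. -/
theorem rogers_reflection (a : Cut) : rog a + rog a.symm = 2 * mkQ (of simplexTwo) := by
  have hE := mkQ_simplexTwo_cut a
  simp only [rog, Cut.symm_x, sub_sub_cancel]
  linear_combination -2 * hE

/-- `R(1/2) = [Λ₂]`. -/
theorem rog_cutHalf : rog cutHalf = mkQ (of simplexTwo) := by
  have hE := mkQ_simplexTwo_cut cutHalf
  rw [cutHalf_symm] at hE
  simp only [rog, cutHalf_x, inv_inv, show (1 - 2⁻¹ : ℝ)⁻¹ = 2 by norm_num] at hE ⊢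
  linear_combination -hE

/-- `6·R(1/2) = x_π²`. -/
theorem six_mul_rog_cutHalf : 6 * rog cutHalf = xPi ^ 2 := by
  rw [rog_cutHalf, six_mul_mkQ_simplexTwo]

/-! ## The golden values -/

/-- `5·R(1/φ) = x_π²`. -/
theorem five_mul_rog_goldCut₁ : 5 * rog goldCut₁ = xPi ^ 2 := by
  have h := ten_mul_dilogGoldOne
  have e : rog goldCut₁ = 2 * mkQ (of dilogGoldOne) + ell φ * (2 • ell φ) := by
    rw [rog, goldCut₁_x, inv_goldenRatio_sub_one, show (1 : ℝ) - (φ - 1) = 2 - φ by ring,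
      inv_two_sub_goldenRatio, ell_goldenRatio_sq]
  rw [e, nsmul_eq_mul, Nat.cast_ofNat]
  linear_combination h

/-- `15·R(1/φ²) = 2·x_π²`. -/
theorem fifteen_mul_rog_goldCut₂ : 15 * rog goldCut₂ = 2 * xPi ^ 2 := by
  have h := fifteen_mul_dilogGoldTwo
  have e : rog goldCut₂ = 2 * mkQ (of dilogGoldTwo) + 2 • ell φ * ell φ := by
    rw [rog, goldCut₂_x, inv_two_sub_goldenRatio, show (1 : ℝ) - (2 - φ) = φ - 1 by ring,
      inv_goldenRatio_sub_one, ell_goldenRatio_sq]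
  rw [e, nsmul_eq_mul, Nat.cast_ofNat]
  linear_combination 2 * h

/-! ## Ramanujan's ladder in Rogers' form -/

/-- `ℓ(9) = 2ℓ(3)`. -/
theorem ell_nine : ell ((3 : ℝ)⁻¹ * 3⁻¹)⁻¹ = 2 * ell 3 := by
  have h := ell_eq_sum_smul (isAlgebraic_three.pow 2) (by norm_num) (fun _ : Fin 1 => (3 : ℝ))
    (fun _ => isAlgebraic_three) (fun _ => by norm_num) (fun _ => 2)
    (by rw [Fin.sum_univ_one, Rat.cast_ofNat, Real.log_pow, Nat.cast_ofNat])
  rw [show ((3 : ℝ)⁻¹ * 3⁻¹)⁻¹ = 3 ^ 2 by norm_num, h, Fin.sum_univ_one, Rat.cast_ofNat,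
    ofNat_smul_eq_nsmul, nsmul_eq_mul, Nat.cast_ofNat]

/-- `ℓ(9/8) = 2ℓ(3) − 3ℓ(2)`. -/
theorem ell_nine_eighths : ell (1 - (3 : ℝ)⁻¹ * 3⁻¹)⁻¹ = 2 * ell 3 - 3 * ell 2 := by
  have h9 : Real.log 9 = 2 * Real.log 3 := by
    rw [show (9 : ℝ) = 3 ^ 2 by norm_num, Real.log_pow, Nat.cast_ofNat]
  have h8 : Real.log 8 = 3 * Real.log 2 := by
    rw [show (8 : ℝ) = 2 ^ 3 by norm_num, Real.log_pow, Nat.cast_ofNat]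
  have h2 : IsAlgebraic ℚ (2 : ℝ) := by simpa using isAlgebraic_nat (R := ℚ) (A := ℝ) 2
  have h := ell_eq_sum_smul ((isAlgebraic_one.sub (isAlgebraic_three.inv.mul
      isAlgebraic_three.inv)).inv) (show (1 : ℝ) < (1 - 3⁻¹ * 3⁻¹)⁻¹ by norm_num) ![3, 2]
    (fun k => by fin_cases k <;> [exact isAlgebraic_three; exact h2])
    (fun k => by fin_cases k <;> norm_num) ![2, -3]
    (by
      rw [Fin.sum_univ_two, show (1 - 3⁻¹ * 3⁻¹ : ℝ)⁻¹ = 9 / 8 by norm_num,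
        Real.log_div (by norm_num) (by norm_num), h9, h8]
      simp
      ring)
  rw [h, Fin.sum_univ_two]
  simp only [Matrix.cons_val_zero, Matrix.cons_val_one, Rat.cast_ofNat, Rat.cast_neg, neg_smul,
    ofNat_smul_eq_nsmul, nsmul_eq_mul, Nat.cast_ofNat]
  ring

/-- **Ramanujan's ladder in Rogers' form:** `6·R(1/3) − R(1/9) = 4[Λ₂]`. -/
theorem ramanujan_rogers :
    6 * rog cutThird - rog (cutThird.mul cutThird) = 4 * mkQ (of simplexTwo) := by
  have hR := ramanujan_ladder
  have e3 : ell (1 - (3 : ℝ)⁻¹)⁻¹ = ell 3 - ell 2 := by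
    rw [show (1 - 3⁻¹ : ℝ)⁻¹ = 1 + 2⁻¹ by norm_num, ell_three_halves]
  simp only [rog, cutThird_x, Cut.mul_x, inv_inv, e3, ell_nine, ell_nine_eighths]
  linear_combination 2 * hR

/-- `3·(6·R(1/3) − R(1/9)) = 2·x_π²`. -/
theorem ramanujan_rogers_xPi :
    3 * (6 * rog cutThird - rog (cutThird.mul cutThird)) = 2 * xPi ^ 2 := by
  rw [ramanujan_rogers, ← six_mul_mkQ_simplexTwo]
  ring

/-! ## Period shadows -/

/-- `2L(1/2) = π²/6`. -/
theorem rog_cutHalf_value :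
    2 * (dilogCut cutHalf).value + Real.log 2⁻¹⁻¹ * Real.log (1 - 2⁻¹)⁻¹ = Real.pi ^ 2 / 6 := by
  have h := congrArg evalQ rog_cutHalf
  rwa [evalQ_rog, evalQ_mkQ, eval_of, simplexTwo_value] at h

/-- `5·2L(1/φ) = π²`, i.e. `L(1/φ) = π²/10`. -/
theorem rog_goldCut₁_value :
    5 * (2 * (dilogCut goldCut₁).value + Real.log (φ - 1)⁻¹ * Real.log (1 - (φ - 1))⁻¹) =
      Real.pi ^ 2 := by
  have h := congrArg evalQ five_mul_rog_goldCut₁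
  rwa [map_mul, map_ofNat, evalQ_rog, map_pow, evalQ_xPi] at h

/-- `6·2L(1/3) − 2L(1/9) = 2π²/3`, i.e. `6L(1/3) − L(1/9) = π²/3`. -/
theorem ramanujan_rogers_value :
    6 * (2 * (dilogCut cutThird).value + Real.log 3⁻¹⁻¹ * Real.log (1 - 3⁻¹)⁻¹) -
      (2 * (dilogCut (cutThird.mul cutThird)).value +
        Real.log (3⁻¹ * 3⁻¹)⁻¹ * Real.log (1 - 3⁻¹ * 3⁻¹)⁻¹) = 2 * Real.pi ^ 2 / 3 := by
  have h := congrArg evalQ ramanujan_rogers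
  rw [map_sub, map_mul, map_mul, map_ofNat, map_ofNat, evalQ_rog, evalQ_rog, evalQ_mkQ, eval_of,
    simplexTwo_value, Cut.mul_x, cutThird_x] at h
  rw [h]
  ring

end SoloBlind

end Summit.KontsevichZagierPeriods.KontsevichZagierPeriods.Theorems
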